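import Mathlib
import HarnessLib
import Summits.ResolutionOfSingularities.ResolutionOfSingularities.Theorems.HomologicalConductorPersistenceKnorrerTransfer

/-!
# Crux `Persistence` (stmt-ResolutionOfSingularities-16484), chain W4.4b — KILL CANDIDATE K-C3,
# condition (γ): the two Knörrer-lifted LOSS certificates `z, t ∉ caⁿ(k[x,y,z,t]/(xy − z³ − t⁴))`

Route `ResolutionOfSingularities/HomologicalConductor`.  OURS (cell res-hironaka, crux chain W4.4b,
CHAIN v13.2 §V13.10 K-C3 (γ) «upper bound … reduces to the two certificates z ∉ ca(A), t ∉ ca(A) =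
Knörrer lifts of z, t ∉ 𝔠 on the 3-generator normalisation MF of z³ + t⁴ — kernel-feasible now»;
planner res-L1-w44b-plan-1; seat res-D-pv-058); nothing here is a statement of the manuscript under
review (Hironaka 2017); AI-written, weaker than expert review.

Over `S = k[z,t]` (`z = X 0`, `t = X 1`, `k` any commutative ring) the NORMALISATION of the `E₆` curve
`h = z³ + t⁴ = 0` (`k[s]`, `z ↦ −s⁴`, `t ↦ s³`, generators `1, s, s²`) has the 3 × 3 matrix
factorisation
  `φ = !![z, 0, t²; t, z, 0; 0, t, z]`,  `ψ = adj φ = !![z², t³, −zt²; −zt, z², t³; t², −zt, z²]`,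
  `φ ψ = ψ φ = (z³ + t⁴) • 1` (`phi_mul_psi`, `psi_mul_phi`).
CERTIFICATES (linear functionals, characteristic-free):
* `μ_t(X) = coeff_t(X₀₀)` kills every `G ψ` (column 0 of `ψ` lies in `(z,t)²`) and every `φ E`
  (`(φE)₀₀ = z E₀₀ + t² E₂₀` has no `t`-term), while `μ_t(t • 1) = 1`: **`not_exists_certificate_t`**;
* `μ_z(X) = coeff_z(X₀₀) − coeff_t(X₁₀)` kills every `G ψ` and every `φ E` (`(φE)₀₀ ↦ E₀₀(0)`,
  `(φE)₁₀ = t E₀₀ + z E₁₀ ↦ E₀₀(0)`), while `μ_z(z • 1) = 1`: **`not_exists_certificate_z`**.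
Hence (`z`, `t` are NOT in the stable annihilator of the normalisation module = conductor `(z,t)²`),
and by res-type-010's U13 `KnorrerTransfer.not_mem_cohomologyAnnihilatorOfDegree_knorrer` (Knörrer
double + res-D-pv-026's LOST criterion p521040): for every `S`-algebra `S′` with a retraction killing
`x, y` and `x y − h` a non-zero-divisor, **`z, t ∉ caⁿ(S′ ⧸ (x y − h))` for all `n`**
(`X0_not_mem_cohomologyAnnihilatorOfDegree_knorrer`, `X1_…`); concretely for `S′ = S[x,y]`
(`…_polynomial`): `z̄, t̄ ∉ caⁿ(k[z,t][x,y] ⧸ (x y − z³ − t⁴))`, `k` a field — the ring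
`A = k[x,y,z,t]/(xy − z³ − t⁴)` of K-C3 in iterated-polynomial presentation.

[folklore]/OURS; mechanism: Knörrer 1987 §2 [`Knorrer1987`], conductor of a plane branch.
-/

noncomputable section

-- single-problem summit: the doubled namespace component `ResolutionOfSingularities` is forced
set_option linter.dupNamespace false

open MvPolynomial Literature.RingTheory.CohomologyAnnihilator
open Summit.ResolutionOfSingularities.ResolutionOfSingularities.Theorems.HomologicalConductor.KnorrerTransfer

universe u

namespace Summit.ResolutionOfSingularities.ResolutionOfSingularities.Theorems.HomologicalConductor.LossE6Curve

variable (k : Type u) [CommRing k]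

/- The normalisation matrix factorisation of `h = z³ + t⁴` over `k[z,t]` (`z = X 0`, `t = X 1`):
`φ = !![z, 0, t²; t, z, 0; 0, t, z]` (presentation matrix of `k[s]`, `z ↦ −s⁴`, `t ↦ s³`, on `1, s, s²`)
and `ψ = adj φ`; written out literally in every statement (def-free file). -/

/-- `φ ψ = (z³ + t⁴) • 1`. [OURS] -/
theorem phi_mul_psi :
    (!![X 0, 0, X 1 ^ 2; X 1, X 0, 0; 0, X 1, X 0] : Matrix (Fin 3) (Fin 3) (MvPolynomial (Fin 2) k)) *
      (!![X 0 ^ 2, X 1 ^ 3, -(X 0 * X 1 ^ 2); -(X 0 * X 1), X 0 ^ 2, X 1 ^ 3; X 1 ^ 2, -(X 0 * X 1), X 0 ^ 2] : Matrix (Fin 3) (Fin 3) (MvPolynomial (Fin 2) k)) =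
      (X 0 ^ 3 + X 1 ^ 4 : MvPolynomial (Fin 2) k) • 1 := by
  ext i j
  fin_cases i <;> fin_cases j <;>
    simp [Matrix.mul_apply, Fin.sum_univ_three] <;> ring

/-- `ψ φ = (z³ + t⁴) • 1`. [OURS] -/
theorem psi_mul_phi :
    (!![X 0 ^ 2, X 1 ^ 3, -(X 0 * X 1 ^ 2); -(X 0 * X 1), X 0 ^ 2, X 1 ^ 3; X 1 ^ 2, -(X 0 * X 1), X 0 ^ 2] : Matrix (Fin 3) (Fin 3) (MvPolynomial (Fin 2) k)) *
      (!![X 0, 0, X 1 ^ 2; X 1, X 0, 0; 0, X 1, X 0] : Matrix (Fin 3) (Fin 3) (MvPolynomial (Fin 2) k)) =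
      (X 0 ^ 3 + X 1 ^ 4 : MvPolynomial (Fin 2) k) • 1 := by
  ext i j
  fin_cases i <;> fin_cases j <;>
    simp [Matrix.mul_apply, Fin.sum_univ_three] <;> ring

/-! ## Coefficient bookkeeping in `k[z,t]` -/

section Coeff

variable {k}

/-- `coeff_m (p · monomial s) = 0` unless `s ≤ m`. [folklore] -/
theorem coeff_mul_monomial_of_not_le {σ : Type*} (m s : σ →₀ ℕ) (h : ¬ s ≤ m)
    (p : MvPolynomial σ k) (r : k) : coeff m (p * monomial s r) = 0 := by
  rw [coeff_mul_monomial', if_neg h]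

/-- `coeff_m (monomial s · p) = 0` unless `s ≤ m`. [folklore] -/
theorem coeff_monomial_mul_of_not_le {σ : Type*} (m s : σ →₀ ℕ) (h : ¬ s ≤ m)
    (p : MvPolynomial σ k) (r : k) : coeff m (monomial s r * p) = 0 := by
  rw [coeff_monomial_mul', if_neg h]

/-- The degree-one coefficients (`z` or `t`) of `p · q` vanish for `q ∈ {z², −zt, t²}` (the column-0
entries of `ψ`, all of degree 2). [folklore] -/
theorem coeff_single_one_mul_col0 (i : Fin 2) (p : MvPolynomial (Fin 2) k) :
    coeff (Finsupp.single i 1) (p * X 0 ^ 2) = 0 ∧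
      coeff (Finsupp.single i 1) (p * (X 0 * X 1)) = 0 ∧
        coeff (Finsupp.single i 1) (p * X 1 ^ 2) = 0 := by
  have hX : ∀ j : Fin 2, (X j : MvPolynomial (Fin 2) k) = monomial (Finsupp.single j 1) 1 := fun j => rfl
  have h2 : ∀ (j : Fin 2), ¬ Finsupp.single j 2 ≤ Finsupp.single i 1 := by
    intro j hle
    have := hle j
    simp only [Finsupp.single_eq_same, Finsupp.single_apply] at this
    split_ifs at this <;> omega
  have h11 : ¬ (Finsupp.single (0 : Fin 2) 1 + Finsupp.single 1 1) ≤ Finsupp.single i 1 := by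
    intro hle
    fin_cases i
    · have := hle 1; simp at this
    · have := hle 0; simp at this
  refine ⟨?_, ?_, ?_⟩
  · rw [X_pow_eq_monomial, coeff_mul_monomial_of_not_le _ _ (h2 0)]
  · rw [hX, hX, monomial_mul, coeff_mul_monomial_of_not_le _ _ (by simpa using h11)]
  · rw [X_pow_eq_monomial, coeff_mul_monomial_of_not_le _ _ (h2 1)]

/-- `coeff_t (z · p) = 0`, `coeff_z (t · p) = 0`. [folklore] -/
theorem coeff_single_one_X_mul_of_ne {i j : Fin 2} (hij : i ≠ j) (p : MvPolynomial (Fin 2) k) :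
    coeff (Finsupp.single i 1) (X j * p) = 0 := by
  rw [coeff_X_mul', if_neg]
  rw [Finsupp.mem_support_iff, Finsupp.single_apply, if_neg hij]
  simp

/-- `coeff_{X i} (X i · p) = p(0)`. [folklore] -/
theorem coeff_single_one_X_mul_self (i : Fin 2) (p : MvPolynomial (Fin 2) k) :
    coeff (Finsupp.single i 1) (X i * p) = coeff 0 p := by
  rw [coeff_X_mul', if_pos (by simp), tsub_self]

/-- `coeff_{X i} (t² · p) = 0`. [folklore] -/
theorem coeff_single_one_X1sq_mul (i : Fin 2) (p : MvPolynomial (Fin 2) k) :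
    coeff (Finsupp.single i 1) (X 1 ^ 2 * p) = 0 := by
  rw [X_pow_eq_monomial, coeff_monomial_mul_of_not_le]
  intro hle
  have := hle 1
  fin_cases i <;> simp at this

end Coeff

/-! ## The two certificates -/

/-- **No certificate for `t`**: `t • 1 ∉ {G ψ + φ E}` over `k[z,t]`, `k` any nontrivial commutative
ring (functional `μ_t = coeff_t(X₀₀)`). Equivalently (U7c) `t` does not stably annihilate the
normalisation module `coker φ̄` of the `E₆` curve — `t ∉ 𝔠 = (z,t)²`. [OURS · w44b K-C3 (γ)] -/
theorem not_exists_certificate_t [Nontrivial k] :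
    ¬ ∃ G E : Matrix (Fin 3) (Fin 3) (MvPolynomial (Fin 2) k),
      (X 1 : MvPolynomial (Fin 2) k) • (1 : Matrix (Fin 3) (Fin 3) (MvPolynomial (Fin 2) k)) =
        G * (!![X 0 ^ 2, X 1 ^ 3, -(X 0 * X 1 ^ 2); -(X 0 * X 1), X 0 ^ 2, X 1 ^ 3; X 1 ^ 2, -(X 0 * X 1), X 0 ^ 2] : Matrix (Fin 3) (Fin 3) (MvPolynomial (Fin 2) k)) +
          (!![X 0, 0, X 1 ^ 2; X 1, X 0, 0; 0, X 1, X 0] : Matrix (Fin 3) (Fin 3) (MvPolynomial (Fin 2) k)) * E := by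
  rintro ⟨G, E, h⟩
  have h00 := congrArg (fun M : Matrix (Fin 3) (Fin 3) (MvPolynomial (Fin 2) k) =>
    coeff (Finsupp.single 1 1) (M 0 0)) h
  simp only [Matrix.smul_apply, Matrix.one_apply_eq, smul_eq_mul, mul_one, Matrix.add_apply,
    Matrix.mul_apply, Fin.sum_univ_three, coeff_add] at h00
  obtain ⟨a0, b0, c0⟩ := coeff_single_one_mul_col0 (k := k) 1 (G 0 0)
  obtain ⟨a1, b1, c1⟩ := coeff_single_one_mul_col0 (k := k) 1 (G 0 1)
  obtain ⟨a2, b2, c2⟩ := coeff_single_one_mul_col0 (k := k) 1 (G 0 2)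
  simp [a0, b1, c2, coeff_single_one_X_mul_of_ne (k := k) (show (1 : Fin 2) ≠ 0 by decide),
    coeff_single_one_X1sq_mul, coeff_X] at h00

/-- **No certificate for `z`**: `z • 1 ∉ {G ψ + φ E}` over `k[z,t]`, `k` nontrivial (functional
`μ_z = coeff_z(X₀₀) − coeff_t(X₁₀)`: on `φ E` both pieces equal the constant term of `E₀₀`).
Equivalently `z` does not stably annihilate the normalisation module — `z ∉ 𝔠 = (z,t)²`.
[OURS · w44b K-C3 (γ)] -/
theorem not_exists_certificate_z [Nontrivial k] :
    ¬ ∃ G E : Matrix (Fin 3) (Fin 3) (MvPolynomial (Fin 2) k),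
      (X 0 : MvPolynomial (Fin 2) k) • (1 : Matrix (Fin 3) (Fin 3) (MvPolynomial (Fin 2) k)) =
        G * (!![X 0 ^ 2, X 1 ^ 3, -(X 0 * X 1 ^ 2); -(X 0 * X 1), X 0 ^ 2, X 1 ^ 3; X 1 ^ 2, -(X 0 * X 1), X 0 ^ 2] : Matrix (Fin 3) (Fin 3) (MvPolynomial (Fin 2) k)) +
          (!![X 0, 0, X 1 ^ 2; X 1, X 0, 0; 0, X 1, X 0] : Matrix (Fin 3) (Fin 3) (MvPolynomial (Fin 2) k)) * E := by
  rintro ⟨G, E, h⟩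
  have h00 := congrArg (fun M : Matrix (Fin 3) (Fin 3) (MvPolynomial (Fin 2) k) =>
    coeff (Finsupp.single 0 1) (M 0 0)) h
  have h10 := congrArg (fun M : Matrix (Fin 3) (Fin 3) (MvPolynomial (Fin 2) k) =>
    coeff (Finsupp.single 1 1) (M 1 0)) h
  simp only [Matrix.smul_apply, Matrix.one_apply_eq, Matrix.one_apply_ne (show (1 : Fin 3) ≠ 0 by decide),
    smul_eq_mul, mul_one, mul_zero, Matrix.add_apply, Matrix.mul_apply, Fin.sum_univ_three,
    coeff_add, coeff_zero] at h00 h10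
  obtain ⟨a0, b0, c0⟩ := coeff_single_one_mul_col0 (k := k) 0 (G 0 0)
  obtain ⟨a1, b1, c1⟩ := coeff_single_one_mul_col0 (k := k) 0 (G 0 1)
  obtain ⟨a2, b2, c2⟩ := coeff_single_one_mul_col0 (k := k) 0 (G 0 2)
  obtain ⟨d0, e0, f0⟩ := coeff_single_one_mul_col0 (k := k) 1 (G 1 0)
  obtain ⟨d1, e1, f1⟩ := coeff_single_one_mul_col0 (k := k) 1 (G 1 1)
  obtain ⟨d2, e2, f2⟩ := coeff_single_one_mul_col0 (k := k) 1 (G 1 2)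
  simp [a0, b1, c2, d0, e1, f2, coeff_single_one_X_mul_self,
    coeff_single_one_X_mul_of_ne (k := k) (show (1 : Fin 2) ≠ 0 by decide),
    coeff_single_one_X1sq_mul, coeff_X] at h00 h10
  -- h00 : 1 = coeff 0 (E 0 0), h10 : 0 = coeff 0 (E 0 0)
  exact one_ne_zero (h00.trans h10.symm)

/-! ## The Knörrer lifts: `z, t ∉ caⁿ` of the threefold `x y = z³ + t⁴` -/

/-- **`z̄ ∉ caⁿ(S′ ⧸ (xy − h))` for every Knörrer double** of `h = z³ + t⁴`: `S′` any noetherian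
`k[z,t]`-algebra with a ring retraction `π` killing `x, y` and `x y − h` a non-zero-divisor (res-type-010
U13 `not_mem_cohomologyAnnihilatorOfDegree_knorrer` applied to `not_exists_certificate_z`). [OURS] -/
theorem X0_not_mem_cohomologyAnnihilatorOfDegree_knorrer [Nontrivial k] {S' : Type u} [CommRing S']
    [Algebra (MvPolynomial (Fin 2) k) S'] [IsNoetherianRing S'] (π : S' →+* MvPolynomial (Fin 2) k)
    (hπ : ∀ s, π (algebraMap (MvPolynomial (Fin 2) k) S' s) = s) (x y : S') (hx : π x = 0)
    (hy : π y = 0)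
    (hf : x * y - algebraMap (MvPolynomial (Fin 2) k) S' (X 0 ^ 3 + X 1 ^ 4) ∈ nonZeroDivisors S')
    (m : ℕ) :
    Ideal.Quotient.mk (Ideal.span ({x * y - algebraMap (MvPolynomial (Fin 2) k) S' (X 0 ^ 3 + X 1 ^ 4)}
        : Set S')) (algebraMap (MvPolynomial (Fin 2) k) S' (X 0)) ∉
      cohomologyAnnihilatorOfDegree
        (S' ⧸ Ideal.span ({x * y - algebraMap (MvPolynomial (Fin 2) k) S' (X 0 ^ 3 + X 1 ^ 4)}
          : Set S')) m :=
  not_mem_cohomologyAnnihilatorOfDegree_knorrer π hπ _ _ (X 0 ^ 3 + X 1 ^ 4)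
    (phi_mul_psi k) (psi_mul_phi k) x y hx hy hf (X 0) (not_exists_certificate_z k) m

/-- **`t̄ ∉ caⁿ(S′ ⧸ (xy − h))` for every Knörrer double** of `h = z³ + t⁴` (same hypotheses;
`not_exists_certificate_t`). [OURS] -/
theorem X1_not_mem_cohomologyAnnihilatorOfDegree_knorrer [Nontrivial k] {S' : Type u} [CommRing S']
    [Algebra (MvPolynomial (Fin 2) k) S'] [IsNoetherianRing S'] (π : S' →+* MvPolynomial (Fin 2) k)
    (hπ : ∀ s, π (algebraMap (MvPolynomial (Fin 2) k) S' s) = s) (x y : S') (hx : π x = 0)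
    (hy : π y = 0)
    (hf : x * y - algebraMap (MvPolynomial (Fin 2) k) S' (X 0 ^ 3 + X 1 ^ 4) ∈ nonZeroDivisors S')
    (m : ℕ) :
    Ideal.Quotient.mk (Ideal.span ({x * y - algebraMap (MvPolynomial (Fin 2) k) S' (X 0 ^ 3 + X 1 ^ 4)}
        : Set S')) (algebraMap (MvPolynomial (Fin 2) k) S' (X 1)) ∉
      cohomologyAnnihilatorOfDegree
        (S' ⧸ Ideal.span ({x * y - algebraMap (MvPolynomial (Fin 2) k) S' (X 0 ^ 3 + X 1 ^ 4)}
          : Set S')) m :=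
  not_mem_cohomologyAnnihilatorOfDegree_knorrer π hπ _ _ (X 0 ^ 3 + X 1 ^ 4)
    (phi_mul_psi k) (psi_mul_phi k) x y hx hy hf (X 1) (not_exists_certificate_t k) m

/-! ## The concrete threefold `k[z,t][x,y] ⧸ (x y − z³ − t⁴)` -/

section Concrete

variable (K : Type u) [Field K]

/-- In `S[x,y]` (`S = K[z,t]`, `x = X 0`, `y = X 1` of the outer ring) the element `x y − h` is a
non-zero-divisor (`S[x,y]` is a domain and the `xy`-coefficient is `1`). [folklore] -/
theorem xy_sub_h_mem_nonZeroDivisors :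
    (X 0 * X 1 - algebraMap (MvPolynomial (Fin 2) K) (MvPolynomial (Fin 2) (MvPolynomial (Fin 2) K))
        (X 0 ^ 3 + X 1 ^ 4) : MvPolynomial (Fin 2) (MvPolynomial (Fin 2) K)) ∈
      nonZeroDivisors (MvPolynomial (Fin 2) (MvPolynomial (Fin 2) K)) := by
  apply mem_nonZeroDivisors_of_ne_zero
  intro h0
  have h1 := congrArg (coeff (Finsupp.single 0 1 + Finsupp.single 1 1)) h0
  rw [MvPolynomial.algebraMap_eq, coeff_sub, coeff_C, if_neg, sub_zero, coeff_zero,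
    show (X 0 * X 1 : MvPolynomial (Fin 2) (MvPolynomial (Fin 2) K)) =
      monomial (Finsupp.single 0 1 + Finsupp.single 1 1) 1 from by
        rw [show (X 0 : MvPolynomial (Fin 2) (MvPolynomial (Fin 2) K)) = monomial (Finsupp.single 0 1) 1
          from rfl, show (X 1 : MvPolynomial (Fin 2) (MvPolynomial (Fin 2) K)) =
          monomial (Finsupp.single 1 1) 1 from rfl, monomial_mul, mul_one],
    coeff_monomial, if_pos rfl] at h1
  · exact one_ne_zero h1
  · intro h
    have := congrArg (fun f : Fin 2 →₀ ℕ => f 0) h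
    simp at this

/-- **K-C3 (γ), `z`**: in `A = K[z,t][x,y] ⧸ (x y − z³ − t⁴)` (`K` a field, any characteristic),
the class of `z` lies in NO `caⁿ(A)`. [OURS · w44b K-C3 (γ)] -/
theorem z_not_mem_cohomologyAnnihilatorOfDegree_polynomial (m : ℕ) :
    Ideal.Quotient.mk (Ideal.span ({X 0 * X 1 - algebraMap (MvPolynomial (Fin 2) K)
        (MvPolynomial (Fin 2) (MvPolynomial (Fin 2) K)) (X 0 ^ 3 + X 1 ^ 4)} : Set _))
        (algebraMap (MvPolynomial (Fin 2) K) (MvPolynomial (Fin 2) (MvPolynomial (Fin 2) K)) (X 0)) ∉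
      cohomologyAnnihilatorOfDegree (MvPolynomial (Fin 2) (MvPolynomial (Fin 2) K) ⧸
        Ideal.span ({X 0 * X 1 - algebraMap (MvPolynomial (Fin 2) K)
          (MvPolynomial (Fin 2) (MvPolynomial (Fin 2) K)) (X 0 ^ 3 + X 1 ^ 4)} : Set _)) m :=
  X0_not_mem_cohomologyAnnihilatorOfDegree_knorrer K
    (MvPolynomial.aeval (fun _ : Fin 2 => (0 : MvPolynomial (Fin 2) K))).toRingHom
    (fun s => by simp) (X 0) (X 1) (by simp) (by simp) (xy_sub_h_mem_nonZeroDivisors K) m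

/-- **K-C3 (γ), `t`**: in `A = K[z,t][x,y] ⧸ (x y − z³ − t⁴)` the class of `t` lies in NO `caⁿ(A)`.
[OURS · w44b K-C3 (γ)] -/
theorem t_not_mem_cohomologyAnnihilatorOfDegree_polynomial (m : ℕ) :
    Ideal.Quotient.mk (Ideal.span ({X 0 * X 1 - algebraMap (MvPolynomial (Fin 2) K)
        (MvPolynomial (Fin 2) (MvPolynomial (Fin 2) K)) (X 0 ^ 3 + X 1 ^ 4)} : Set _))
        (algebraMap (MvPolynomial (Fin 2) K) (MvPolynomial (Fin 2) (MvPolynomial (Fin 2) K)) (X 1)) ∉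
      cohomologyAnnihilatorOfDegree (MvPolynomial (Fin 2) (MvPolynomial (Fin 2) K) ⧸
        Ideal.span ({X 0 * X 1 - algebraMap (MvPolynomial (Fin 2) K)
          (MvPolynomial (Fin 2) (MvPolynomial (Fin 2) K)) (X 0 ^ 3 + X 1 ^ 4)} : Set _)) m :=
  X1_not_mem_cohomologyAnnihilatorOfDegree_knorrer K
    (MvPolynomial.aeval (fun _ : Fin 2 => (0 : MvPolynomial (Fin 2) K))).toRingHom
    (fun s => by simp) (X 0) (X 1) (by simp) (by simp) (xy_sub_h_mem_nonZeroDivisors K) m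

end Concrete

/-! ## Presentation `K[x,y,z,t] = MvPolynomial (Fin 4) K` (`x,y,z,t = X 0, X 1, X 2, X 3`) -/

section Fin4

variable (K : Type u) [Field K]

/-- `x y − z³ − t⁴ ≠ 0` in `K[x,y,z,t]`, hence a non-zero-divisor (its `xy`-coefficient is `1`).
[folklore] -/
theorem xy_sub_h_mem_nonZeroDivisors_fin4 :
    (X 0 * X 1 - (X 2 ^ 3 + X 3 ^ 4) : MvPolynomial (Fin 4) K) ∈
      nonZeroDivisors (MvPolynomial (Fin 4) K) := by
  apply mem_nonZeroDivisors_of_ne_zero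
  intro h0
  have h1 := congrArg (coeff (Finsupp.single 0 1 + Finsupp.single 1 1)) h0
  have hxy : (X 0 * X 1 : MvPolynomial (Fin 4) K) =
      monomial (Finsupp.single 0 1 + Finsupp.single 1 1) 1 := by
    rw [show (X 0 : MvPolynomial (Fin 4) K) = monomial (Finsupp.single 0 1) 1 from rfl,
      show (X 1 : MvPolynomial (Fin 4) K) = monomial (Finsupp.single 1 1) 1 from rfl, monomial_mul,
      mul_one]
  have h2 : ¬ Finsupp.single (2 : Fin 4) 3 = Finsupp.single 0 1 + Finsupp.single 1 1 := by
    intro h; have := congrArg (fun f : Fin 4 →₀ ℕ => f 2) h; simp at this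
  have h3 : ¬ Finsupp.single (3 : Fin 4) 4 = Finsupp.single 0 1 + Finsupp.single 1 1 := by
    intro h; have := congrArg (fun f : Fin 4 →₀ ℕ => f 3) h; simp at this
  rw [coeff_sub, coeff_add, hxy, coeff_monomial, if_pos rfl, coeff_X_pow, if_neg h2, coeff_X_pow,
    if_neg h3, add_zero, sub_zero, coeff_zero] at h1
  exact one_ne_zero h1

/-- **K-C3 (γ) in the presentation `K[x,y,z,t] ⧸ (x y − z³ − t⁴)`** (`K` a field, any
characteristic): the classes of `z = X 2` and `t = X 3` lie in NO `caⁿ`.  (The `K[z,t]`-algebra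
structure on `K[x,y,z,t]` is `rename (z ↦ X 2, t ↦ X 3)`, the retraction is `aeval ![0, 0, z, t]`;
then `X0_/X1_not_mem_cohomologyAnnihilatorOfDegree_knorrer`.) [OURS · w44b K-C3 (γ)] -/
theorem z_t_not_mem_cohomologyAnnihilatorOfDegree_fin4 (m : ℕ) :
    Ideal.Quotient.mk (Ideal.span ({X 0 * X 1 - (X 2 ^ 3 + X 3 ^ 4)} : Set (MvPolynomial (Fin 4) K)))
        (X 2) ∉ cohomologyAnnihilatorOfDegree (MvPolynomial (Fin 4) K ⧸
          Ideal.span ({X 0 * X 1 - (X 2 ^ 3 + X 3 ^ 4)} : Set (MvPolynomial (Fin 4) K))) m ∧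
      Ideal.Quotient.mk (Ideal.span ({X 0 * X 1 - (X 2 ^ 3 + X 3 ^ 4)} : Set (MvPolynomial (Fin 4) K)))
        (X 3) ∉ cohomologyAnnihilatorOfDegree (MvPolynomial (Fin 4) K ⧸
          Ideal.span ({X 0 * X 1 - (X 2 ^ 3 + X 3 ^ 4)} : Set (MvPolynomial (Fin 4) K))) m := by
  let ι : MvPolynomial (Fin 2) K →+* MvPolynomial (Fin 4) K :=
    (rename (fun i : Fin 2 => (Fin.natAdd 2 i : Fin 4))).toRingHom
  letI : Algebra (MvPolynomial (Fin 2) K) (MvPolynomial (Fin 4) K) := ι.toAlgebra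
  have hι : ∀ s, algebraMap (MvPolynomial (Fin 2) K) (MvPolynomial (Fin 4) K) s =
      rename (fun i : Fin 2 => (Fin.natAdd 2 i : Fin 4)) s := fun s => rfl
  let π : MvPolynomial (Fin 4) K →+* MvPolynomial (Fin 2) K :=
    (aeval (![0, 0, X 0, X 1] : Fin 4 → MvPolynomial (Fin 2) K)).toRingHom
  have hπX : ∀ i, π (X i) = (![0, 0, X 0, X 1] : Fin 4 → MvPolynomial (Fin 2) K) i := fun i => by
    simp [π]
  have hπ : ∀ s, π (algebraMap (MvPolynomial (Fin 2) K) (MvPolynomial (Fin 4) K) s) = s := by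
    intro s
    rw [hι]
    change aeval _ (rename _ s) = s
    rw [aeval_rename]
    have hcomp : ((![0, 0, X 0, X 1] : Fin 4 → MvPolynomial (Fin 2) K) ∘
        fun i : Fin 2 => (Fin.natAdd 2 i : Fin 4)) = X := by
      funext i; fin_cases i <;> rfl
    rw [hcomp, aeval_X_left, AlgHom.id_apply]
  have eh : algebraMap (MvPolynomial (Fin 2) K) (MvPolynomial (Fin 4) K) (X 0 ^ 3 + X 1 ^ 4) =
      X 2 ^ 3 + X 3 ^ 4 := by
    rw [hι, map_add, map_pow, map_pow, rename_X, rename_X]; rfl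
  have ez : algebraMap (MvPolynomial (Fin 2) K) (MvPolynomial (Fin 4) K) (X 0) = X 2 := by
    rw [hι, rename_X]; rfl
  have et : algebraMap (MvPolynomial (Fin 2) K) (MvPolynomial (Fin 4) K) (X 1) = X 3 := by
    rw [hι, rename_X]; rfl
  have hf : (X 0 * X 1 : MvPolynomial (Fin 4) K) -
      algebraMap (MvPolynomial (Fin 2) K) (MvPolynomial (Fin 4) K) (X 0 ^ 3 + X 1 ^ 4) ∈
        nonZeroDivisors (MvPolynomial (Fin 4) K) := by
    rw [eh]; exact xy_sub_h_mem_nonZeroDivisors_fin4 K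
  have kz := X0_not_mem_cohomologyAnnihilatorOfDegree_knorrer K π hπ (X 0) (X 1)
    (by rw [hπX]; rfl) (by rw [hπX]; rfl) hf m
  have kt := X1_not_mem_cohomologyAnnihilatorOfDegree_knorrer K π hπ (X 0) (X 1)
    (by rw [hπX]; rfl) (by rw [hπX]; rfl) hf m
  rw [ez] at kz
  rw [et] at kt
  rw [eh] at kz kt
  exact ⟨kz, kt⟩

end Fin4

end Summit.ResolutionOfSingularities.ResolutionOfSingularities.Theorems.HomologicalConductor.LossE6Curve
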